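import Literature.NumberTheory.Automorphic.LocalComponentBJGenericProofs
import Literature.NumberTheory.Automorphic.AutomorphicRepsGLSatakeDictionaryHolds
import Literature.NumberTheory.Automorphic.SatakeParameterGenericBoundFlathProofs
import Literature.NumberTheory.Automorphic.PAdicRepsJacquetAdmissibilityHolds
import Literature.NumberTheory.Automorphic.ParabolicInductionAdmissibleProofs
import Literature.NumberTheory.Automorphic.JacquetLanglandsParts
import Literature.NumberTheory.Automorphic.AutomorphicTwistSatake
import Literature.NumberTheory.Automorphic.BaseChangeStrongUnramifiedUnitaryReduction
import HarnessLib

/-!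
# Satake parameters of a cuspidal Borel–Jacquet datum are Satake parameters of its local
# components (Flath 1979, Thm. 3 / Borel–Jacquet 1979, 4.6 — for the subquotient model `W / W'`)

Topic `Literature/NumberTheory/Automorphic`; proof file (theorems only: no definition, no named
fact, no instance), companion of `LocalComponentBJGenericProofs` (same reduction, genericity
replaced by Satake parameters).

**Theorem** (`CuspidalAutomorphicRepData.isSatakeParameter_of_hasLocalComponentAt`).  Let
`π = W / W'` be a cuspidal automorphic representation of `GL_n(𝔸_K)` in the sense of Borel–Jacquet
(`n ≥ 1`), `v` a finite place, `ρ` an irreducible smooth local component of `π` at `v`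
(`AutomorphicRepData.HasLocalComponentAt`) and `α` a Satake parameter of `π` at `v`
(`AutomorphicRepData.HasSatakeParamAt`: Hecke eigenvalues modulo `W'` of a level-`K(𝔫)` form in
`W ∖ W'`).  Then `α` is a Satake parameter of `ρ` (`IsSatakeParameter ρ ϖ' α` of
`SatakeParametersGL`) for every uniformizer `ϖ'` of `K_v`.  In print: `π ≅ ⊗' π_w` and
`π^{K(𝔫)} = π_v^{GL_n(𝒪_v)} ⊗ (π^v)^{K(𝔫)^v}` (Flath 1979, Thm. 3; Bump 1997, Thm. 3.3.3;
Borel–Jacquet 1979, 4.6).  Over the tree's objects the printed setting (a subrepresentation of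
`L²_cusp`) is reached exactly as in `LocalComponentBJGenericProofs`:

1. clean model `π₀ = C / ⊥` (`IsShiftRealisation`; local components and Satake parameters are
   preserved: `IsShiftRealisation.hasLocalComponentAt`, `IsShiftRealisation.hasSatakeParamAt_iff`);
2. twist by `|det|_𝔸^s`, `s n [K:ℚ] = -μ₀`, to reach `A_G`-invariance
   (`HasLocalComponentAt.map_mulChar`: the local component becomes `ρ ⊗ c_v`;
   `HasSatakeParamAt.of_map_mulChar_detTwist_of_cpow`: the Satake parameter becomes `q_v^{-s} α`);
3. association with `Π ≤ L²_cusp` (`exists_isAssociatedL2_holds`), `L²` local component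
   (`HasLocalComponentAt.toL2`) and `L²` Satake parameter
   (`exists_hasSatakeParameterAt_of_hasSatakeParamAt`, Borel–Jacquet 1979, 4.6, proved in
   `AutomorphicRepsGLSatakeDictionaryHolds`);
4. Flath's dictionary for `L²` (`Flath1979_isSatakeParameter_of_hasLocalComponentAt_holds`;
   admissibility of `ρ ⊗ c_v` by Jacquet's theorem `jacquetAdmissibility_gl_holds`);
5. untwist (`IsSatakeParameter.of_twist`): `c_v = |det|_v^s` is trivial on `GL_n(𝒪_v)` and equals
   `(q_v^{-s})^i` on the double coset of `T_i`, so `T_i(ρ ⊗ c_v) = (q_v^{-s})^i T_i(ρ)`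
   (`heckeOperator_twist_apply`) while `e_i(q_v^{-s} α) = (q_v^{-s})^i e_i(α)`.

## References

* D. Flath, *Decomposition of representations into tensor products*, Corvallis 1979, Thm. 3. [Flath1979]
* A. Borel, H. Jacquet, *Automorphic forms and automorphic representations*, Corvallis 1979,
  §4.6 and 5.7. [BorelJacquetCorvallis1979]
* D. Bump, *Automorphic forms and representations* (1997), Thm. 3.3.3. [Bump1997]
* J. Arthur, L. Clozel, *Simple algebras, base change …* (1989), Ch. 3, proof of Thm. 3.1
  (`t_{π ⊗ χ, v} = χ(ϖ_v) t_{π,v}`). [ArthurClozelAMS120]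
-/

noncomputable section

open scoped MatrixGroups NNReal Classical
open NumberField IsDedekindDomain MeasureTheory ValuativeRel

namespace Literature.NumberTheory.Automorphic

/-! ### Hecke operators of a twist by a character trivial on the level -/

section LocalTwist

variable {k G V : Type*} [CommRing k] [Group G] [AddCommGroup V] [Module k V]

/-- **`[U g U](ρ ⊗ c) = c(g) [U g U](ρ)`** for a character `c` trivial on `U` (`c` is constant,
equal to `c g`, on the representatives of the left cosets in `U g U`). (Arthur–Clozel 1989, Ch. 3,
proof of Thm. 3.1: `t_{π ⊗ χ, v} = χ(ϖ_v) t_{π,v}`.) [folklore] -/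
theorem heckeOperator_twist_apply (ρ : Representation k G V) (c : G →* kˣ) (U : Subgroup G)
    (hU : ∀ u ∈ U, c u = 1) (g : G) (v : V) :
    heckeOperator (ρ.twist c) U g v = ((c g : kˣ) : k) • heckeOperator ρ U g v := by
  classical
  by_cases hfin : (MulAction.orbit U (g : G ⧸ U)).Finite
  · rw [heckeOperator, heckeOperator, finsum_mem_eq_finite_toFinset_sum _ hfin,
      finsum_mem_eq_finite_toFinset_sum _ hfin, LinearMap.sum_apply, LinearMap.sum_apply,
      Finset.smul_sum]
    refine Finset.sum_congr rfl fun y hy => ?_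
    rw [Representation.twist_apply,
      apply_out_eq_of_mem_orbit c U hU g ((Set.Finite.mem_toFinset _).mp hy)]
  · rw [heckeOperator_eq_zero_of_infinite _ U g hfin, heckeOperator_eq_zero_of_infinite _ U g hfin,
      LinearMap.zero_apply]
    exact (smul_zero _).symm

/-- The `U`-fixed vectors of `ρ ⊗ c` and of `ρ` coincide for `c` trivial on `U`. [folklore] -/
theorem mem_fixedPoints_twist_iff (ρ : Representation k G V) (c : G →* kˣ) (U : Subgroup G)
    (hU : ∀ u ∈ U, c u = 1) (v : V) : v ∈ (ρ.twist c).fixedPoints U ↔ v ∈ ρ.fixedPoints U := by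
  rw [Representation.mem_fixedPoints, Representation.mem_fixedPoints]
  refine forall₂_congr fun u hu => ?_
  rw [Representation.twist_apply, hU u hu, Units.val_one, one_smul]

end LocalTwist

/-! ### Untwisting a Satake parameter -/

section SatakeTwist

variable {F : Type*} [Field F] [ValuativeRel F] [TopologicalSpace F] [IsNonarchimedeanLocalField F]
  {n : ℕ} {V : Type*} [AddCommGroup V] [Module ℂ V]

/-- **Satake parameters of `ρ ⊗ c` for `c` unramified**: if `c` is trivial on `GL_n(𝒪)` and takes
the value `zⁱ` at `diag(ϖ,…,ϖ,1,…,1)` (`i` entries `ϖ`), `z ≠ 0`, and `z α` is a Satake parameter of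
`ρ ⊗ c`, then `α` is a Satake parameter of `ρ` (`Tᵢ(ρ ⊗ c) = zⁱ Tᵢ(ρ)` on the common spherical
vectors, `eᵢ(z α) = zⁱ eᵢ(α)`). (Arthur–Clozel 1989, Ch. 3, proof of Thm. 3.1; Cartier 1979, §IV.)
[cite: CartierCorvallis1979, §IV.1] -/
theorem IsSatakeParameter.of_twist {ρ : Representation ℂ (GL (Fin n) F) V} {c : GL (Fin n) F →* ℂˣ}
    (hc : ∀ u ∈ glInt n F, c u = 1) {z : ℂ} (hz : z ≠ 0) {ϖ : Fˣ}
    (hcz : ∀ i ≤ n, ((c (heckeDiag n ϖ i) : ℂˣ) : ℂ) = z ^ i) {α : Multiset ℂ}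
    (h : IsSatakeParameter (ρ.twist c) ϖ (α.map (z * ·))) : IsSatakeParameter ρ ϖ α := by
  obtain ⟨hcard, v, hv, hv0, hT⟩ := h
  rw [Multiset.card_map] at hcard
  refine ⟨hcard, v, (mem_fixedPoints_twist_iff ρ c _ hc v).1 hv, hv0, fun i hi => ?_⟩
  have h1 := hT i hi
  rw [heckeT_def, heckeOperator_twist_apply ρ c _ hc, hcz i hi, esymm_map_const_mul, ← heckeT_def]
    at h1
  apply smul_right_injective V (pow_ne_zero i hz)
  change z ^ i • heckeT ρ ϖ i v = z ^ i • _
  rw [h1, smul_smul]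
  congr 1
  ring

end SatakeTwist

/-! ### The dictionary for Borel–Jacquet data -/

section Main

open Literature.NumberTheory.GaloisRepresentations (HeckeCharacter ideleGroup)

variable {n : ℕ} {K : Type} [Field K] [NumberField K] {hcpt : isCompact_glFiniteIntegralLevel n K}

/-- **Satake parameters of a cuspidal Borel–Jacquet datum are Satake parameters of its local
components** (Flath 1979, Thm. 3; Borel–Jacquet 1979, 4.6; Bump 1997, Thm. 3.3.3).  Let
`π = W / W'` be cuspidal on `GL_n(𝔸_K)` (`n ≥ 1`), `v` finite, `ρ` an irreducible smooth local
component of `π` at `v` and `α` a Satake parameter of `π` at `v`; then `IsSatakeParameter ρ ϖ' α`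
for every uniformizer `ϖ'` of `K_v`.  Reduction to `L²` as in the module docstring (clean model,
`|det|^s`-twist, association, Flath's `L²` dictionary, untwist).
[cite: Flath1979, Thm. 3] [cite: BorelJacquetCorvallis1979, §4.6 and 5.7] -/
theorem CuspidalAutomorphicRepData.isSatakeParameter_of_hasLocalComponentAt [NeZero n]
    (π : CuspidalAutomorphicRepData n K hcpt) (v : HeightOneSpectrum (𝓞 K))
    {V : Type} [AddCommGroup V] [Module ℂ V]
    (ρ : Representation ℂ (GL (Fin n) (v.adicCompletion K)) V) [ρ.IsIrreducible] (hsm : ρ.IsSmooth)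
    (hloc : π.1.HasLocalComponentAt v ρ) {α : Multiset ℂ} (hα : π.1.HasSatakeParamAt v α)
    {ϖ' : (v.adicCompletion K)ˣ}
    (hϖ' : (valuation (v.adicCompletion K)).IsUniformizer (ϖ' : v.adicCompletion K)) :
    IsSatakeParameter ρ ϖ' α := by
  classical
  -- 1. the clean model `π₀ = C / ⊥`, `A_G` acting by `a ↦ a^μ₀`
  obtain ⟨π₀, μ₀, j, M, hsh⟩ := π.exists_isShiftRealisation_of_sSup_irreducible
    AutomorphicRepsGL.stable_cuspidal_eq_sSup_irreducible_holds
  have h0 : π₀.1.HasLocalComponentAt v ρ := hsh.hasLocalComponentAt hloc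
  have hα0 : π₀.1.HasSatakeParamAt v α := hsh.hasSatakeParamAt_iff.1 hα
  -- 2. the twist by `|det|_𝔸^s`, `s n [K:ℚ] = -μ₀`, is clean and `A_G`-invariant
  have hN : ((n * Module.finrank ℚ K : ℕ) : ℂ) ≠ 0 := by
    exact_mod_cast (Nat.mul_ne_zero (NeZero.ne n) Module.finrank_pos.ne')
  set s : ℂ := -μ₀ / ((n * Module.finrank ℚ K : ℕ) : ℂ) with hs_def
  have hs : s * (n * Module.finrank ℚ K : ℕ) = -μ₀ := by
    rw [hs_def, div_mul_cancel₀ _ hN]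
  obtain ⟨χ, hχ⟩ := exists_heckeCharacter_ideleNorm_cpow K s
  obtain ⟨π₁, hW₁, hW₁'⟩ := exists_cuspidalAutomorphicRepData_map_mulChar_detTwist hχ π₀
  obtain ⟨cχ, hcχ⟩ : ∃ cv : GL (Fin n) (v.adicCompletion K) →* ℂˣ,
      ∀ g, cv g = detTwist n χ (GLn.ofLocal n K v g) :=
    ⟨(detTwist n χ).comp (GLn.ofLocal n K v), fun g => rfl⟩
  have h1 : π₁.1.HasLocalComponentAt v (ρ.twist cχ) := h0.map_mulChar (detTwist n χ) hW₁ hW₁' cχ hcχ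
  have hα1 : π₁.1.HasSatakeParamAt v (α.map (((v.residueCard : ℂ) ^ (-s)) * ·)) :=
    AutomorphicRepData.HasSatakeParamAt.of_map_mulChar_detTwist_of_cpow hχ hW₁ hW₁' hα0
  have hbot₁ : π₁.1.W' = ⊥ := by rw [hW₁', hsh.bot, Submodule.map_bot]
  have hinv₁ : ∀ φ ∈ π₁.1.W, ∀ z ∈ (AdelicGroupData.gl n K).center', ∀ g, φ (z * g) = φ g := by
    intro φ hφ z hz g
    rw [hW₁] at hφ
    obtain ⟨c, hc, rfl⟩ := hφ
    obtain ⟨t, rfl⟩ := hz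
    exact mulChar_detTwist_apply_posRealScalar_mul_of_cpow hχ hs
      (fun t' g' => hsh.apply_posRealScalar_mul hc t' g') t g
  -- 3. the associated `L²` representation, its local component `ρ ⊗ cχ` and its Satake parameter
  obtain ⟨μA, hμA⟩ := AdelicGroupData.exists_isAutomorphicMeasure_gl_holds (n := n) (K := K)
  haveI := hμA
  obtain ⟨P, hP⟩ := AutomorphicRepsGL.exists_isAssociatedL2_holds (hcpt := hcpt) (μ := μA) π₁ hinv₁
  have h2 : Automorphic.HasLocalComponentAt P.1 v (ρ.twist cχ) := h1.toL2 hbot₁ hP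
  obtain ⟨𝔫, ϖ, h𝔫, hv𝔫, hα2⟩ := exists_hasSatakeParameterAt_of_hasSatakeParamAt hP hα1
  -- 4. `ρ ⊗ cχ` is irreducible, smooth (`cχ` is trivial on `GL_n(𝒪_v)`), hence admissible (Jacquet)
  haveI : (ρ.twist cχ).IsIrreducible := ρ.isIrreducible_twist cχ
  have hcK' : ∀ k ∈ valuedCongruenceSubgroup (Fin n) (1 : WithZero (Multiplicative ℤ)), cχ k = 1 := by
    intro k hk
    rw [hcχ, detTwist_apply']
    exact apply_det_eq_one_of_mem_finiteLevelsGL hχ (glIntegralLevel_mem_finiteLevelsGL n K hcpt)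
      (isMaximalAt_glIntegralLevel n K v ⟨k, hk, rfl⟩)
  have hker : IsOpen ((cχ.ker : Subgroup (GL (Fin n) (v.adicCompletion K))) :
      Set (GL (Fin n) (v.adicCompletion K))) :=
    Subgroup.isOpen_mono (H₁ := valuedCongruenceSubgroup (Fin n) (1 : WithZero (Multiplicative ℤ)))
      (fun k hk => by rw [MonoidHom.mem_ker]; exact hcK' k hk)
      (isOpen_valuedCongruenceSubgroup n K v one_ne_zero)
  have hsm' : (ρ.twist cχ).IsSmooth := hsm.twist hker
  have hadm : (ρ.twist cχ).IsAdmissible :=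
    Representation.isAdmissible_of_jacquetAdmissibilityStatement_fin
      (jacquetAdmissibility_gl_holds (v.adicCompletion K) n) _ hsm'
  -- 5. Flath's `L²` dictionary
  have h5 : IsSatakeParameter (ρ.twist cχ) ϖ' (α.map (((v.residueCard : ℂ) ^ (-s)) * ·)) :=
    Flath1979_isSatakeParameter_of_hasLocalComponentAt_holds P h𝔫 hv𝔫 hα2 (ρ.twist cχ) hadm h2 hϖ'
  -- 6. untwist: `cχ = |det|_v^s` is `1` on `GL_n(𝒪_v)` and `(q_v^{-s})^i` at `diag(ϖ'^{(i)}, 1)`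
  have hz : (v.residueCard : ℂ) ^ (-s) ≠ 0 := by
    rw [Ne, Complex.cpow_eq_zero_iff, not_and_or]
    exact Or.inl (by exact_mod_cast v.one_lt_residueCard.ne_bot)
  have hcK : ∀ u ∈ glInt n (v.adicCompletion K), cχ u = 1 := by
    intro u hu
    rw [glInt_adicCompletion_eq] at hu
    exact hcK' u hu
  have hval : valuation (v.adicCompletion K) ((ϖ : (v.adicCompletion K)ˣ) : v.adicCompletion K) =
      valuation (v.adicCompletion K) ((ϖ' : (v.adicCompletion K)ˣ) : v.adicCompletion K) :=
    (isUniformizingElement_of_valued_eq K v hα2.1).valuation_eq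
      (isUniformizingElement_of_isUniformizer hϖ')
  have hϖ'v : Valued.v ((ϖ' : (v.adicCompletion K)ˣ) : v.adicCompletion K) =
      WithZero.exp (-1 : ℤ) := by
    rw [← hα2.1]
    exact ((ValuativeRel.isEquiv (valuation (v.adicCompletion K))
      (Valued.v : Valuation (v.adicCompletion K) _)).eq_iff.1 hval).symm
  have hcz : ∀ i ≤ n, ((cχ (heckeDiag n ϖ' i) : ℂˣ) : ℂ) = ((v.residueCard : ℂ) ^ (-s)) ^ i := by
    intro i hi
    rw [hcχ, ← heckeDiagAt_eq_ofLocal]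
    exact detTwist_heckeDiagAt_of_cpow hχ hϖ'v hi
  exact IsSatakeParameter.of_twist hcK hz hcz h5

end Main

end Literature.NumberTheory.Automorphic

end
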